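import Summits.QuantumFields.YangMills.Theorems.IR.AfPincerUcSharpOnset
import Summits.QuantumFields.YangMills.Theorems.IR.MomentumPincerNoLightMoversSC
import HarnessLib

/-!
# Crux `IR` (stmt-QuantumFields-19354) — line `momentum-pincer` (ideator ym-ir-idea-5, lens: RP transfer-matrix bounds) — v1.6

v1.6 (2026-08-28, idea-5 g6): rung R1 `stub_noLightMoversSC` CLOSED BY NAME (`MomentumPincerRung.noLightMoversSC_holds`, p597050); stub set otherwise
UNCHANGED (R2 `stub_noLightMoversSCTransfer`, Z1 `stub_zeroMomentumClustering`, Z2 `stub_noLightMovers` open); registry entry NOT rewritten (RULING g9-№1 (4)).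

The transfer matrix of the periodic slice `(2S+1)³` commutes with the spatial translations, so its spectrum on `Ω^⊥` is graded by
the lattice momentum `p⃗ ∈ ((2π)/(2S+1)) ℤ³`.  `GapInUnits` (= `IR`'s conclusion) is the statement `inf_{p⃗} E(p⃗) ≥ c₁ a(β)`;
this line splits it along the momentum grading into

* **Z1 `ZeroMomentumClustering`** (thermodynamic half): the ZERO-MOMENTUM = slice-summed connected correlators
  `Σ_{x⃗} ⟨A_{(0,x⃗)} ; B_{(t,0⃗)}⟩_{2S+1}` of all species decay at rate `c₁ a(β)` — for `A = B =` plaquette this is the slice–slice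
  specific-heat kernel `∂² log Z / ∂β_s ∂β_{s+t}` of the torus with LAYERED couplings, i.e. the interaction free energy of two defect
  hyperplanes (a pressure-level quantity: no point observable, reflection-symmetric, chessboard-shaped);
* **Z2 `NoLightMovers`** (spectral-condition half — NOT kinematic at weak coupling (crit-1): the lattice spectral condition `E(p⃗) ≥ min(E(0⃗), c₂)`): zero-momentum clustering at any
  rate `m(β)` transfers to point clustering at rate `min(m(β), c₂)` with `c₂ > 0` a LATTICE-SCALE constant — no state of non-zero
  momentum is lighter than both the zero-momentum gap and the cutoff scale (no glueball doublers), thermal face included;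

and the kernel-checked glue `IR_of : ZeroMomentumClustering → NoLightMovers → Theses.BalabanLadder.IR` (`a → 0` makes
`min(c₁ a(β), c₂) = c₁ a(β)` eventually).  Model-free typing: only `latticeConnectedCorr` and `configShift`.

HONEST FRAMING: a typed modus-ponens split of ONE open gap-crux of a CONDITIONAL chain (R4 closes only the finite-𝕋⁴ UV rung
`BalabanLadder.UV`); both stubs are OPEN; nothing here proves a lattice mass gap, a continuum limit, or the Clay problem.
-/

set_option autoImplicit false

noncomputable section

open Filter Topology MeasureTheory
open scoped SchwartzMap
open Literature.MathematicalPhysics.QuantumFieldTheory Literature.MathematicalPhysics.QuantumLattice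
open Summit.QuantumFields.YangMills.Cruxes.OSLegsFromFemtoAndGap.DlrCollarTransfer (GapInUnits LowerBounds Q2)
open Summit.QuantumFields.YangMills.Cruxes.IR.AfPincerUc (IRCal)

namespace Summit.QuantumFields.YangMills.Cruxes.IR.MomentumPincer

variable {G : Type} [Group G] [TopologicalSpace G] [IsTopologicalGroup G] [CompactSpace G]
  [MeasurableSpace G] [BorelSpace G]

/-! ## §1 Zero-momentum (slice-summed) correlators -/

/-- The purely spatial `ℤ⁴`-vector `(0, x⃗)` below a spatial torus site `x⃗ ∈ (ℤ/(2S+1))³` (centred representatives). -/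
def spatialVec (S : ℕ) (x : Fin 3 → ZMod (2 * S + 1)) : Fin 4 → ℤ :=
  fun i => if h : i = 0 then 0 else (x (i.pred h)).valMinAbs

/-- **Zero-momentum connected time-correlation** on the torus `(2S+1)⁴`: the slice sum over all spatial translates of `A`
against `B` at Euclidean time `t`, `Σ_{x⃗} (⟨(A∘θ_{(0,x⃗)}) · τ_{t e₀} B⟩ − ⟨A∘θ_{(0,x⃗)}⟩⟨B⟩)` (an `O(1)` quantity when correlations
are summable; for `A = B =` plaquette it is the slice–slice covariance of the action per unit slice volume). -/
def sliceSumCorr {N : ℕ} (ρ : G →* Matrix (Fin N) (Fin N) ℂ) (β : ℝ) (S : ℕ) (A B : LGConfig 4 G → ℝ) (t : ℕ) : ℝ :=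
  ∑ x : Fin 3 → ZMod (2 * S + 1),
    latticeConnectedCorr ρ β (2 * S + 1) (fun U => A (configShift (spatialVec S x) U)) B t

/-! ## §2 The two stubs -/

/-- **Z1 — zero-momentum clustering in units** (thermodynamic half).  Same quantifier shape as `GapInUnits`, with the
slice-summed correlator in place of the point correlator. -/
def ZeroMomentumClustering : Prop :=
  ∀ (G : Type) [Group G] [TopologicalSpace G] [IsTopologicalGroup G] [CompactSpace G],
    IsCompactSimpleLieGroup G → letI : MeasurableSpace G := borel G; haveI : BorelSpace G := ⟨rfl⟩;
    ∀ (r : LatticeRep G) (a : ℝ → ℝ), (∀ β, 0 < a β) → Tendsto a atTop (𝓝 0) → LowerBounds G r a →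
      ∃ (c₁ β₂ : ℝ) (S₁ : ℝ → ℕ), 0 < c₁ ∧ ∀ A B : YMSpecies G, ∃ C : ℝ, ∀ β : ℝ, β₂ ≤ β →
        ∀ S t : ℕ, S₁ β ≤ S → t ≤ S →
          |sliceSumCorr r.ρ β S A.F B.F t| ≤ C * Real.exp (-(c₁ * a β * t))

/-- **Z2 — no light movers** (the lattice SPECTRAL CONDITION `E(p⃗) ≥ θ·min(E(0⃗), c₂)` in correlator form, thermal face included; relabelled per
ym-ir-crit-1 23:52Z: NOT kinematic at weak coupling — the smallest torus momentum `2π/(2S+1) → 0`, so this is a gap statement in every small-momentum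
sector, as hard as restoring the relativistic dispersion relation; size L at strong coupling, XL at weak coupling).  For every `(G, r)` there is a lattice-scale constant `c₂ > 0` such that zero-momentum clustering at any positive rate
`m(β)` (volume-uniform beyond `S₁ β`, for `β ≥ β₂`) transfers to point clustering of every species pair at rate `θ·min(m(β), c₂)` for a fixed
`θ ∈ (0,1]` (typing-checklist (iv): no hand-picked relative constant — a lattice dispersion `E(p⃗)` dipping below `E(0⃗)` by a bounded FACTOR is
tolerated; only a light mover at a parametrically smaller scale refutes it). -/
def NoLightMovers : Prop :=
  ∀ (G : Type) [Group G] [TopologicalSpace G] [IsTopologicalGroup G] [CompactSpace G],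
    IsCompactSimpleLieGroup G → letI : MeasurableSpace G := borel G; haveI : BorelSpace G := ⟨rfl⟩;
    ∀ r : LatticeRep G, ∃ c₂ θ : ℝ, 0 < c₂ ∧ 0 < θ ∧
      ∀ (m : ℝ → ℝ) (β₂ : ℝ) (S₁ : ℝ → ℕ), (∀ β, 0 < m β) →
        (∀ A B : YMSpecies G, ∃ C : ℝ, ∀ β : ℝ, β₂ ≤ β → ∀ S t : ℕ, S₁ β ≤ S → t ≤ S →
            |sliceSumCorr r.ρ β S A.F B.F t| ≤ C * Real.exp (-(m β * t))) →
        ∃ (β₃ : ℝ) (S₃ : ℝ → ℕ), ∀ A B : YMSpecies G, ∃ C : ℝ, ∀ β : ℝ, β₃ ≤ β → ∀ S t : ℕ, S₃ β ≤ S → t ≤ S →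
            |latticeConnectedCorr r.ρ β (2 * S + 1) A.F B.F t| ≤ C * Real.exp (-(θ * min (m β) c₂ * t))

/-- **Z2-SC — the strong-coupling rung of Z2** (FIRST PROVER TARGET, size S/M; a BC5-style witness in the regime `0 < β ≤ β₀`,
which lies OUTSIDE `IR`'s `β → ∞` regime and is NOT evidence for Z2 at weak coupling): point clustering of every species pair on all odd
tori `(2S+1)⁴`, `t ≤ S`, at a window-uniform lattice rate `c` with window-uniform constants.  It gives `NoLightMovers` restricted to the
window outright (take `c₂ := c`, `θ := 1`; the zero-momentum hypothesis is not even needed there).  Derivation path (v1.5, `Lines/momentum-pincer-rungs.md` R1): the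
TYPE of the tree's PROVED `osterwalder_seiler_torusClustering_uniform_holds` exports a per-β constant `Kunif·e^{m(β)c}` with `m(β) = log(r/β) → ∞`,
so do NOT instantiate it per β; re-run the last 60 lines of its proof (`UniformTorusClusteringProofs`) with the FIXED mass `1` on `β ≤ r/e`
(`(β/r)^n ≤ e^{−n}`) via the public `PlaqSystem.norm_truncatedExpect_le(_const)`, constant `Kunif·e^{c_AB}` β-independent; then `L = 2S`,
`x = −t e₀` and the dictionary `SoloBlind.latticeConnectedCorr_eq_wilsonExpectation` + `wilsonExpectation_comp_torusConfigShift`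
(verbatim the tail of `SoloBlind.clustersUniformlyAt_of_strongCoupling`).
In d = 3 the sharper isolated-dispersion-curve statement is Schor, CMP 92 (1984) (printed); in d = 4 this rung is the honest substitute. -/
def NoLightMoversSC : Prop :=
  ∀ (G : Type) [Group G] [TopologicalSpace G] [IsTopologicalGroup G] [CompactSpace G],
    IsCompactSimpleLieGroup G → letI : MeasurableSpace G := borel G; haveI : BorelSpace G := ⟨rfl⟩;
    ∀ r : LatticeRep G, ∃ β₀ c : ℝ, 0 < β₀ ∧ 0 < c ∧
      ∀ A B : YMSpecies G, ∃ C : ℝ, ∀ β : ℝ, 0 < β → β ≤ β₀ → ∀ S t : ℕ, t ≤ S →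
        |latticeConnectedCorr r.ρ β (2 * S + 1) A.F B.F t| ≤ C * Real.exp (-(c * t))

/-- STUB 0 (Z2-SC, the strong-coupling rung) — **CLOSED BY NAME** (v1.6): proved by the pooled prover ym-ir-line-bsf-p1 g2 as
`Summit.QuantumFields.YangMills.Cruxes.IR.MomentumPincerRung.noLightMoversSC_holds` (`Theorems/IR/MomentumPincerNoLightMoversSC.lean`,
p597050 ACCEPTED, `--supports stmt-QuantumFields-19354 --as helper`; route = rung plan R1: `torusClustering_uniform_fixedRate` = the proof body of
`osterwalder_seiler_torusClustering_uniform_holds` re-run with FIXED mass `1` on `β ≤ betaOne 4 r.ρ/(2e)`, then the SoloBlind dictionary).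
HONEST: strong coupling only; not evidence for Z2 at weak coupling; proves nothing about IR or the YM gap. -/
theorem stub_noLightMoversSC : NoLightMoversSC :=
  MomentumPincerRung.noLightMoversSC_holds

/-- **Z2-SC-TRANSFER — a rung that exercises the TRANSFER `p⃗ = 0 ⇒ point`, not just the conclusion** (ym-ir-crit-1 23:52Z (b) suggestion): on a
compact strong-coupling window `[β₁, β₀]`, zero-momentum clustering at ANY valid rate `m(β)` transfers to point clustering at rate `θ·m(β)` (no cutoff cap:
at strong coupling every scale is the lattice scale).  Proof plan (size M; v1.5, `Lines/momentum-pincer-rungs.md` R2): a RATE CEILING from RP LOG-CONVEXITY — for the spatial plaquette `P₀` the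
slice-summed self-correlator `s(t)` is `(2S+1)⁻³ ×` the self-correlator of the slice-sum species, hence multiplicatively convex and symmetric on the odd
torus (tree `SoloBlind.latticeConnectedCorr_self_logConvex`, `latticeConnectedCorr_self_symm`, thermal face exact), so `s(t) ≥ s(0)·(s(1)/s(0))^t` for
`t ≤ S` (tree `SoloBlindSpacingPinning.mulConvex_ratio_floor` + `mulConvex_lower_envelope`); one fixed-distance strong-coupling computation gives
`s(1)/s(0) ≥ q = κ β₁⁴ > 0` uniformly in the volume; hence EVERY valid hypothesis rate obeys `m(β) ≤ M := log(1/q)`; the conclusion is then the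
β-uniform OS78 point clustering at rate `1 ≥ θ·m(β)` with `θ := 1/M` (R1's window `β ≤ r/e`, constants via `PlaqSystem.norm_truncatedExpect_le`).
No large-distance Schor/Münster asymptotics are needed (lit-4's d = 3 scope flag is moot here).  HONEST: strong coupling only; exercises the
logic of Z2 where the dispersion relation is computable. -/
def NoLightMoversSCTransfer : Prop :=
  ∀ (G : Type) [Group G] [TopologicalSpace G] [IsTopologicalGroup G] [CompactSpace G],
    IsCompactSimpleLieGroup G → letI : MeasurableSpace G := borel G; haveI : BorelSpace G := ⟨rfl⟩;
    ∀ r : LatticeRep G, ∃ β₁ β₀ θ : ℝ, 0 < β₁ ∧ β₁ < β₀ ∧ 0 < θ ∧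
      ∀ (m : ℝ → ℝ) (S₁ : ℝ → ℕ), (∀ β, 0 < m β) →
        (∀ A B : YMSpecies G, ∃ C : ℝ, ∀ β : ℝ, β₁ ≤ β → β ≤ β₀ → ∀ S t : ℕ, S₁ β ≤ S → t ≤ S →
            |sliceSumCorr r.ρ β S A.F B.F t| ≤ C * Real.exp (-(m β * t))) →
        ∃ S₃ : ℝ → ℕ, ∀ A B : YMSpecies G, ∃ C : ℝ, ∀ β : ℝ, β₁ ≤ β → β ≤ β₀ → ∀ S t : ℕ, S₃ β ≤ S → t ≤ S →
            |latticeConnectedCorr r.ρ β (2 * S + 1) A.F B.F t| ≤ C * Real.exp (-(θ * m β * t))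

/-- STUB 0' (Z2-SC-TRANSFER rung; size M; uses a strong-coupling FLOOR for the plaquette slice sum + OS78 point clustering). -/
theorem stub_noLightMoversSCTransfer : NoLightMoversSCTransfer := by
  sorry

/-- STUB 1 (Z1, thermodynamic half; size XL). -/
theorem stub_zeroMomentumClustering : ZeroMomentumClustering := by
  sorry

/-- STUB 2 (Z2, kinematic half; size L/XL; strong-coupling rung: printed for d = 3 (Schor 1984), d = 4 by the OS78 cluster expansion — new work). -/
theorem stub_noLightMovers : NoLightMovers := by
  sorry

/-! ## §3 Kernel-checked composition to the route decl -/

omit [MeasurableSpace G] [BorelSpace G] in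
/-- **Z1 ∧ Z2 ⇒ `IRCal`** (verbatim body of the route decl): modus ponens at rate `m β = c₁ a β`, then `a → 0` gives
`min (c₁ a β) c₂ = c₁ a β` for `β ≥ β₄`. -/
theorem irCal_of_momentum (h1 : ZeroMomentumClustering) (h2 : NoLightMovers) : IRCal := by
  intro G _ _ _ _ hG
  letI : MeasurableSpace G := borel G
  haveI : BorelSpace G := ⟨rfl⟩
  intro r a ha hat hlb
  obtain ⟨c₁, β₂, S₁, hc₁, hZ⟩ := h1 G hG r a ha hat hlb
  obtain ⟨c₂, θ, hc₂, hθ, hK⟩ := h2 G hG r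
  have hm : ∀ β, 0 < c₁ * a β := fun β => mul_pos hc₁ (ha β)
  obtain ⟨β₃, S₃, hP⟩ := hK (fun β => c₁ * a β) β₂ S₁ hm hZ
  -- eventually `c₁ a β ≤ c₂`
  have hev : ∀ᶠ β in atTop, a β ≤ c₂ / c₁ :=
    hat.eventually (eventually_le_nhds (div_pos hc₂ hc₁))
  obtain ⟨β₄, hβ₄⟩ := Filter.eventually_atTop.mp hev
  refine ⟨θ * c₁, max β₃ β₄, S₃, mul_pos hθ hc₁, fun A B => ?_⟩
  obtain ⟨C, hC⟩ := hP A B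
  refine ⟨C, fun β hβ S t hS ht => ?_⟩
  have hβ3 : β₃ ≤ β := le_trans (le_max_left _ _) hβ
  have hβ4 : β₄ ≤ β := le_trans (le_max_right _ _) hβ
  have hle : c₁ * a β ≤ c₂ := by
    have h := hβ₄ β hβ4
    calc c₁ * a β ≤ c₁ * (c₂ / c₁) := by gcongr
      _ = c₂ := by field_simp
  have hmin : min (c₁ * a β) c₂ = c₁ * a β := min_eq_left hle
  have key : |latticeConnectedCorr r.ρ β (2 * S + 1) A.F B.F t| ≤ C * Real.exp (-(θ * min (c₁ * a β) c₂ * t)) :=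
    hC β hβ3 S t hS ht
  rw [hmin] at key
  have hre : θ * (c₁ * a β) * (t : ℝ) = θ * c₁ * a β * t := by ring
  rw [hre] at key
  exact key

omit [MeasurableSpace G] [BorelSpace G] in
/-- **COMPOSITION (real proof): `ZeroMomentumClustering → NoLightMovers → BalabanLadder.IR`** — the route decl BY NAME. -/
theorem IR_of (h1 : ZeroMomentumClustering) (h2 : NoLightMovers) :
    Summit.QuantumFields.YangMills.Theses.BalabanLadder.IR := by
  have hI : IRCal := irCal_of_momentum h1 h2
  delta Summit.QuantumFields.YangMills.Theses.BalabanLadder.IR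
  delta Summit.QuantumFields.YangMills.Cruxes.IR.AfPincerUc.IRCal at hI
  exact hI

/-- The registered stubs close the crux (kernel-checked modulo the two `sorry`s above). -/
theorem IR_of_stubs : Summit.QuantumFields.YangMills.Theses.BalabanLadder.IR :=
  IR_of stub_zeroMomentumClustering stub_noLightMovers

end Summit.QuantumFields.YangMills.Cruxes.IR.MomentumPincer

end
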